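import Summits.QuantumFields.YangMills.Theorems.FluctuationComparisonRegPrIntLOrganTangentChartRepresentation
import Summits.QuantumFields.YangMills.Theorems.FluctuationComparisonRegPrIntLOrganTangentTiltedVarianceRatio
import HarnessLib

/-!
# Crux `FluctuationComparisonRegPrIntL` (stmt-QuantumFields-20520, rung R3), PATH-B organ, v18 (H-currency) — (JV-rep) THE TILTED FIBRE VARIANCE IS THE CHART
# RATIO AT EVERY WINDOW POINT (the Jensen-side twin of `hrep`; bridge §3 of px5 g19's JVAR-KNIT DOCKING LIST, named to w5 by LEAD w3 g26 №1 (e))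

Cell `ym3-torus` (YM ladder rung R3 = continuum `SU(2)` Yang–Mills on the three-torus — a RUNG: NOT d = 4, NOT infinite volume, NOT a mass gap, NOT Clay).
Width seat `ym-ust-20520-w5` (gen 23), `--supports stmt-QuantumFields-20520 --as helper`, count-neutral, no registry ∕ binder ∕ `Lines/` edit, DEFINITION-FREE,
default heartbeats.  Over ✓(L22) `…OrganTangentChartRepresentation` ((A1′)∕(A3′) explicit), (TV) `…OrganTangentTiltedVarianceRatio`,
✓KNIT `ae_on_of_ae_map_of_ac_of_map_eq`, ✓(L21b) `eq_on_window_of_ae`.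

WHAT THIS IS.  JVARᵘ-H″ (px5's ✓p803829∕✓p805394∕✓p812220 texts) reads the m-step Jensen gap through the VARIANCE of `h := log ρ_K − log ρ′_K` under the
TILTED reweighted fibre law `((lam V)·(χ·ρ′)).tilted (t·h)` of an (A)-package `(σ₀, lam)` of `descendTo F ℰp j K` on the multi-level window; the Jensen knit (LEAD g26)
works on ONE fibred chart `(Z, τ, Φ, J, S)` with the interpolated weights `w_t(V,z) = χ(Φ(V,z))·ρ(Φ(V,z))^t·ρ′(Φ(V,z))^{1−t}·J(V,z)` (FibreLawH's `wNum` body, χ = `mwCut`).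
★★★`tiltedVariance_eq_chartRatio_on_window`: for the (A)-package binders VERBATIM as ✓p803829 (`σ₀` Markov + bind + fibre; `lam` finite, (A1)(A2)(A3)), the chart
letters VERBATIM as ✓(L22) ([6] `hmap` at the window, `havgΦ`, `hS`, (C1′) `hint`, `hJB`∕`B`, (C3) `hmass`), `ρ ρ′` measurable∕window-continuous∕positive, `χ`
continuous `≥ 0` supported in MW and positive there, and transfer data `(rj, hcons)` (discharged by (WD) `…OrganTangentWindowDensity` in the sibling file `…ChartVarianceRepresentationSelf`): for EVERY window `V` and EVERY `t : ℝ`,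
`Var[h; ((lam V).withDensity (ofReal (χ·ρ′))).tilted (t·h)] = (∫ (h(Φ(V,z)) − m_t)²·w_t(V,z) dτ) ∕ (∫ w_t(V,z) dτ)`, `m_t = (∫ h(Φ)·w_t dτ)∕(∫ w_t dτ)` — with
`w_t` spelled `χ (Φ (V,z)) * (Real.rpow (ρ (Φ (V,z))) t * Real.rpow (ρ′ (Φ (V,z))) (1 - t)) * (J (V,z) : ℝ)` (= `wNum`'s token order).
ROUTE (px5 §3 (i)–(iii)): (TV) `Var = (I₂ − 2MI₁ + M²I₀)∕I₀` with `I_k = ∫ e^{th}h^k d((χρ′)·lam V) = ∫ χ·ρ^t·ρ′^{1−t}·h^k d(lam V)` (pointwise `e^{th}·χρ′ = χρ^tρ′^{1−t}` on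
the support of `χ`, where `ρ, ρ′ > 0`); (A3) ∘ (A3′) ⇒ `I_k(V) = (c′V∕cV)·C_k(V)` for `descendTo_* dU_K`-a.e. window `V` with `C_k` the chart moments — the SAME factor for
`k = 0,1,2` — so the two ratios agree a.e. ((TV) `ratio_eq_of_proportional`); `dU_j`-a.e. on the window by ✓KNIT through `(rj, hcons)`; EVERY window point because both
ratios are window-continuous ((A1), (A1′), positivity of `I₀`, `C₀` from (A2)∕(C3) + `χ > 0` on MW) — ✓`eq_on_window_of_ae`; finally (TV) `ratio_eq_integral_centred_sq`.

HONEST FRAMING: tilted-measure ∕ disintegration plumbing over Mathlib and landed kernel facts; nothing of Bałaban's analysis is asserted or proved; JVARᵘ-H″ ∕ (HV) ∕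
SpreadFibreLawH(J) ∕ LIN″ ∕ O1ᵘ-H v2.x ∕ S1aᴴ ∕ 26243 ∕ S2α′ ∕ S2β OPEN; crux 20520 `FluctuationComparisonRegPrIntL` ∕ `YM3TorusSU2` NOT proved; no summit ∕ sub-problem
statement is proved; registry untouched; rung R3 = SU(2) YM₃ on T³ at fixed lattice data — NOT d = 4, NOT infinite volume, NOT a mass gap, NOT Clay; the Yang–Mills mass
gap is NOT proved.  [folklore] measure theory; citations are bookkeeping locators.
-/

set_option autoImplicit false

noncomputable section


namespace Summit.QuantumFields.YangMills.Theorems.OrganTangentChartVarianceRepresentation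

open MeasureTheory ProbabilityTheory Filter Topology Set Function
open scoped ENNReal NNReal
open Literature.MathematicalPhysics.QuantumFieldTheory.Balaban1983to89
open T3ContinuumYM3Torus T3NestedUnitLaws T3UnitLawDensityEML T3UnitScaleTilt T3LevelShift T3TiltDescent T4Continuum
open Literature.MathematicalPhysics.QuantumFieldTheory.Balaban1983to89.T3OrbitAverage
open Literature.MathematicalPhysics.QuantumFieldTheory.Balaban1983to89.T3DescentFibreTower (descendTo_self)
open Summit.QuantumFields.YangMills.Theorems.OrganTangentFibreMeanTools
open Summit.QuantumFields.YangMills.Theorems.FluctuationComparisonRegPrIntLOrganTangentAPackageDescendTo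
  (measurableSet_multiWindow absolutelyContinuous_map_descendTo)
open Summit.QuantumFields.YangMills.Theorems.OrganTangentChartRepresentation (chartIntegrals_descendTo_of_fibredChart)
open Summit.QuantumFields.YangMills.Theorems.OrganTangentTiltedVarianceRatio

/-- ★★★ **(JV-rep) THE TILTED FIBRE VARIANCE IS THE CHART RATIO AT EVERY WINDOW POINT** (module docstring; transfer data `(rj, hcons)` as binders — see `…_self`).
[cite: Balaban1987RG1, (0.11) p.253, (0.13) p.254 and §2 p.264; Balaban1985Averaging, (10)-(13) p.19; Balaban1985UV3, (41)-(47) pp.266-267] -/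
theorem tiltedVariance_eq_chartRatio_on_window
    (F : T3Family) (γ b₀ p₀ : ℝ) (j K : ℕ) (hjK : j + 1 ≤ K) (hθ : 0 < θBal F.L γ b₀ p₀ K)
    (r r' : GaugeField (F.P K) 0 ↥(Matrix.specialUnitaryGroup (Fin 2) ℂ) → ℝ) (hrm : Measurable r) (hrm' : Measurable r')
    (hpos : ∀ U, PlaqSmall (θBal F.L γ b₀ p₀ K) U → 0 < r U ∧ 0 < r' U)
    (hr : ContinuousOn r {U | PlaqSmall (θBal F.L γ b₀ p₀ K) U})
    (hr' : ContinuousOn r' {U | PlaqSmall (θBal F.L γ b₀ p₀ K) U})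
    (χ : GaugeField (F.P K) 0 ↥(Matrix.specialUnitaryGroup (Fin 2) ℂ) → ℝ) (hχc : Continuous χ) (hχ0 : ∀ U, 0 ≤ χ U)
    (hχsupp : ∀ U, χ U ≠ 0 → ∀ (n : ℕ) (hjn : j + 1 ≤ n) (hnK : n ≤ K), PlaqSmall (24 / 25 * θBal F.L γ b₀ p₀ n) (descendTo F ℰp n K hnK U))
    (hχpos : ∀ U, (∀ (n : ℕ) (hjn : j + 1 ≤ n) (hnK : n ≤ K), PlaqSmall (24 / 25 * θBal F.L γ b₀ p₀ n) (descendTo F ℰp n K hnK U)) → 0 < χ U)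
    (σ₀ : Kernel (GaugeField (F.P j) 0 ↥(Matrix.specialUnitaryGroup (Fin 2) ℂ))
      (GaugeField (F.P K) 0 ↥(Matrix.specialUnitaryGroup (Fin 2) ℂ)))
    (hσ₀M : IsMarkovKernel σ₀)
    (hbind₀ : (Measure.map (descendTo F ℰp j K (Nat.le_of_succ_le hjK)) (fieldMeasure (F.P K) 0 ↥(Matrix.specialUnitaryGroup (Fin 2) ℂ))).bind ⇑σ₀ =
      fieldMeasure (F.P K) 0 ↥(Matrix.specialUnitaryGroup (Fin 2) ℂ))
    (hfib₀ : ∀ᵐ V ∂(Measure.map (descendTo F ℰp j K (Nat.le_of_succ_le hjK)) (fieldMeasure (F.P K) 0 ↥(Matrix.specialUnitaryGroup (Fin 2) ℂ))),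
      ∀ᵐ U ∂(σ₀ V), descendTo F ℰp j K (Nat.le_of_succ_le hjK) U = V)
    (lam : GaugeField (F.P j) 0 ↥(Matrix.specialUnitaryGroup (Fin 2) ℂ) →
      Measure (GaugeField (F.P K) 0 ↥(Matrix.specialUnitaryGroup (Fin 2) ℂ)))
    (hlam : ∀ V, IsFiniteMeasure (lam V))
    (hA1 : ∀ f : GaugeField (F.P K) 0 ↥(Matrix.specialUnitaryGroup (Fin 2) ℂ) → ℝ, Continuous f →
      (∀ U, f U ≠ 0 → ∀ (n : ℕ) (hjn : j + 1 ≤ n) (hnK : n ≤ K), PlaqSmall (24 / 25 * θBal F.L γ b₀ p₀ n) (descendTo F ℰp n K hnK U)) →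
      ContinuousOn (fun V => ∫ U, f U ∂(lam V)) {V | PlaqSmall (θBal F.L γ b₀ p₀ j) V})
    (hA2 : ∀ V, PlaqSmall (θBal F.L γ b₀ p₀ j) V → 0 < lam V {U | ∀ (n : ℕ) (hjn : j + 1 ≤ n) (hnK : n ≤ K), PlaqSmall (24 / 25 * θBal F.L γ b₀ p₀ n) (descendTo F ℰp n K hnK U)})
    (hA3 : ∃ c : GaugeField (F.P j) 0 ↥(Matrix.specialUnitaryGroup (Fin 2) ℂ) → ℝ,
      ∀ f : GaugeField (F.P K) 0 ↥(Matrix.specialUnitaryGroup (Fin 2) ℂ) → ℝ, Continuous f →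
        (∀ U, ¬ (∀ (n : ℕ) (hjn : j + 1 ≤ n) (hnK : n ≤ K), PlaqSmall (24 / 25 * θBal F.L γ b₀ p₀ n) (descendTo F ℰp n K hnK U)) → f U = 0) →
        ∀ᵐ V ∂(Measure.map (descendTo F ℰp j K (Nat.le_of_succ_le hjK)) (fieldMeasure (F.P K) 0 ↥(Matrix.specialUnitaryGroup (Fin 2) ℂ))),
          PlaqSmall (θBal F.L γ b₀ p₀ j) V → 0 < c V ∧ ∫ U, f U ∂(σ₀ V) = c V * ∫ U, f U ∂(lam V))
    {Z : Type*} [MeasurableSpace Z] (τ : Measure Z) [SFinite τ]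
    (Φ : GaugeField (F.P j) 0 ↥(Matrix.specialUnitaryGroup (Fin 2) ℂ) × Z → GaugeField (F.P K) 0 ↥(Matrix.specialUnitaryGroup (Fin 2) ℂ))
    (hΦ : Measurable Φ)
    (J : GaugeField (F.P j) 0 ↥(Matrix.specialUnitaryGroup (Fin 2) ℂ) × Z → ℝ≥0) (hJ : Measurable J)
    (S : Set (GaugeField (F.P K) 0 ↥(Matrix.specialUnitaryGroup (Fin 2) ℂ)))
    (hS : ∀ U, (∀ (n : ℕ) (hjn : j + 1 ≤ n) (hnK : n ≤ K), PlaqSmall (24 / 25 * θBal F.L γ b₀ p₀ n) (descendTo F ℰp n K hnK U)) → U ∈ S)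
    (havgΦ : ∀ V ∈ {V | PlaqSmall (θBal F.L γ b₀ p₀ j) V}, ∀ z, descendTo F ℰp j K (Nat.le_of_succ_le hjK) (Φ (V, z)) = V)
    (hmap : (fieldMeasure (F.P K) 0 ↥(Matrix.specialUnitaryGroup (Fin 2) ℂ)).restrict
        (descendTo F ℰp j K (Nat.le_of_succ_le hjK) ⁻¹' {V | PlaqSmall (θBal F.L γ b₀ p₀ j) V} ∩ S) =
      ((((fieldMeasure (F.P j) 0 ↥(Matrix.specialUnitaryGroup (Fin 2) ℂ)).restrict {V | PlaqSmall (θBal F.L γ b₀ p₀ j) V}).prod τ).withDensity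
        (fun p => (J p : ℝ≥0∞))).map Φ)
    (hint : ∀ f : GaugeField (F.P K) 0 ↥(Matrix.specialUnitaryGroup (Fin 2) ℂ) → ℝ, Continuous f →
      (∀ U, f U ≠ 0 → ∀ (n : ℕ) (hjn : j + 1 ≤ n) (hnK : n ≤ K), PlaqSmall (24 / 25 * θBal F.L γ b₀ p₀ n) (descendTo F ℰp n K hnK U)) →
      ∀ᵐ z ∂τ, ContinuousOn (fun V => (J (V, z) : ℝ) * f (Φ (V, z))) {V | PlaqSmall (θBal F.L γ b₀ p₀ j) V})
    (B : Z → ℝ) (hB : Integrable B τ)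
    (hJB : ∀ V, PlaqSmall (θBal F.L γ b₀ p₀ j) V → ∀ᵐ z ∂τ, (J (V, z) : ℝ) ≤ B z)
    (hmass : ∀ V, PlaqSmall (θBal F.L γ b₀ p₀ j) V →
      0 < ∫⁻ z in {z | ∀ (n : ℕ) (hjn : j + 1 ≤ n) (hnK : n ≤ K), PlaqSmall (24 / 25 * θBal F.L γ b₀ p₀ n) (descendTo F ℰp n K hnK (Φ (V, z)))},
        (J (V, z) : ℝ≥0∞) ∂τ)
    (rj : GaugeField (F.P j) 0 ↥(Matrix.specialUnitaryGroup (Fin 2) ℂ) → ℝ) (hrj : Measurable rj)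
    (hrjpos : ∀ V, PlaqSmall (θBal F.L γ b₀ p₀ j) V → 0 < rj V)
    (hcons : Measure.map (descendTo F ℰp j K (Nat.le_of_succ_le hjK)) (fieldMeasure (F.P K) 0 ↥(Matrix.specialUnitaryGroup (Fin 2) ℂ)) =
      (fieldMeasure (F.P j) 0 ↥(Matrix.specialUnitaryGroup (Fin 2) ℂ)).withDensity (fun V => ENNReal.ofReal (rj V))) :
    ∀ V, PlaqSmall (θBal F.L γ b₀ p₀ j) V → ∀ t : ℝ,
      variance (fun U => Real.log (r U) - Real.log (r' U))
          (((lam V).withDensity (fun U => ENNReal.ofReal (χ U * r' U))).tilted (fun U => t * (Real.log (r U) - Real.log (r' U))))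
        = (∫ z, (Real.log (r (Φ (V, z))) - Real.log (r' (Φ (V, z)))
              - (∫ z', (Real.log (r (Φ (V, z'))) - Real.log (r' (Φ (V, z'))))
                  * (χ (Φ (V, z')) * (Real.rpow (r (Φ (V, z'))) t * Real.rpow (r' (Φ (V, z'))) (1 - t)) * (J (V, z') : ℝ)) ∂τ)
                / (∫ z', χ (Φ (V, z')) * (Real.rpow (r (Φ (V, z'))) t * Real.rpow (r' (Φ (V, z'))) (1 - t)) * (J (V, z') : ℝ) ∂τ)) ^ 2
            * (χ (Φ (V, z)) * (Real.rpow (r (Φ (V, z))) t * Real.rpow (r' (Φ (V, z))) (1 - t)) * (J (V, z) : ℝ)) ∂τ)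
          / (∫ z, χ (Φ (V, z)) * (Real.rpow (r (Φ (V, z))) t * Real.rpow (r' (Φ (V, z))) (1 - t)) * (J (V, z) : ℝ) ∂τ) := by
  classical
  haveI : BorelSpace (GaugeField (F.P K) 0 ↥(Matrix.specialUnitaryGroup (Fin 2) ℂ)) := T3OrbitAverage.instBorelSpaceGaugeField
  haveI : BorelSpace (GaugeField (F.P j) 0 ↥(Matrix.specialUnitaryGroup (Fin 2) ℂ)) := T3OrbitAverage.instBorelSpaceGaugeField
  set θK : ℝ := θBal F.L γ b₀ p₀ K with hθK
  set θj : ℝ := θBal F.L γ b₀ p₀ j with hθj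
  set Hf : Measure (GaugeField (F.P K) 0 ↥(Matrix.specialUnitaryGroup (Fin 2) ℂ)) := fieldMeasure (F.P K) 0 ↥(Matrix.specialUnitaryGroup (Fin 2) ℂ) with hHf
  set Hc : Measure (GaugeField (F.P j) 0 ↥(Matrix.specialUnitaryGroup (Fin 2) ℂ)) := fieldMeasure (F.P j) 0 ↥(Matrix.specialUnitaryGroup (Fin 2) ℂ) with hHc
  set W : Set (GaugeField (F.P j) 0 ↥(Matrix.specialUnitaryGroup (Fin 2) ℂ)) := {V | PlaqSmall θj V} with hW
  set OK : Set (GaugeField (F.P K) 0 ↥(Matrix.specialUnitaryGroup (Fin 2) ℂ)) := {U | PlaqSmall θK U} with hOK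
  set MW : Set (GaugeField (F.P K) 0 ↥(Matrix.specialUnitaryGroup (Fin 2) ℂ)) := {U | ∀ (n : ℕ) (hjn : j + 1 ≤ n) (hnK : n ≤ K),
    PlaqSmall (24 / 25 * θBal F.L γ b₀ p₀ n) (descendTo F ℰp n K hnK U)} with hMW
  have hd : Measurable (descendTo F ℰp j K (Nat.le_of_succ_le hjK) :
      GaugeField (F.P K) 0 ↥(Matrix.specialUnitaryGroup (Fin 2) ℂ) → GaugeField (F.P j) 0 ↥(Matrix.specialUnitaryGroup (Fin 2) ℂ)) :=
    measurable_descendTo F ℰp measurableE_ℰp _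
  have hJV : ∀ V, Measurable fun z => J (V, z) := fun V => hJ.comp measurable_prodMk_left
  have hΦV : ∀ V, Measurable fun z => Φ (V, z) := fun V => hΦ.comp measurable_prodMk_left
  -- the multi-window sits inside the open top window, where `r, r′ > 0` are continuous
  have hOKopen : IsOpen OK := by
    have e : OK = ⋂ p : Plaq (F.P K) 0, {U | dist1 (GaugeField.plaqHol U p) < θK} := by
      ext U; simp only [hOK, PlaqSmall, Set.mem_setOf_eq, Set.mem_iInter]
    rw [e]
    exact isOpen_iInter_of_finite fun p => isOpen_lt (continuous_dist1_plaqHol p) continuous_const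
  have hMWtop : ∀ U, U ∈ MW → PlaqSmall (24 / 25 * θK) U := by
    intro U hU
    have h := hU K hjK le_rfl
    rw [descendTo_self] at h; exact h
  have hcut : 24 / 25 * θK < θK := by nlinarith [hθ]
  have hMWOK : ∀ U, U ∈ MW → U ∈ OK := fun U hU p => (hMWtop U hU p).trans hcut
  have hχts : tsupport χ ⊆ OK := tsupport_subset_plaqSmall hcut fun U hU => hMWtop U (hχsupp U hU)
  have hχOK : ∀ U, χ U ≠ 0 → U ∈ OK := fun U hU => hχts (subset_tsupport _ (Function.mem_support.mpr hU))
  have hχ0' : ∀ U, U ∉ MW → χ U = 0 := fun U hU => by by_contra h; exact hU (hχsupp U h)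
  intro V hV t
  -- the discrepancy `h`, the interpolated weight `g₀ = χ·r^t·r′^{1−t}` and its moments `g_k = g₀·h^k`: globally continuous
  have hlogr : ContinuousOn (fun U => Real.log (r U)) OK := hr.log fun U hU => (hpos U hU).1.ne'
  have hlogr' : ContinuousOn (fun U => Real.log (r' U)) OK := hr'.log fun U hU => (hpos U hU).2.ne'
  have hhc : ContinuousOn (fun U => Real.log (r U) - Real.log (r' U)) OK := hlogr.sub hlogr'
  have hrpow : ContinuousOn (fun U => Real.rpow (r U) t * Real.rpow (r' U) (1 - t)) OK := by
    refine ContinuousOn.mul ?_ ?_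
    · exact hr.rpow_const fun U hU => Or.inl (hpos U hU).1.ne'
    · exact hr'.rpow_const fun U hU => Or.inl (hpos U hU).2.ne'
  have hgc : ∀ k : ℕ, Continuous fun U => χ U * ((Real.rpow (r U) t * Real.rpow (r' U) (1 - t)) * (Real.log (r U) - Real.log (r' U)) ^ k) :=
    fun k => continuous_mul_of_tsupport_subset hOKopen hχc hχts (hrpow.mul (hhc.pow k))
  have hgm : ∀ k : ℕ, Measurable fun U => χ U * ((Real.rpow (r U) t * Real.rpow (r' U) (1 - t)) * (Real.log (r U) - Real.log (r' U)) ^ k) :=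
    fun k => (hgc k).measurable
  have hgsupp : ∀ k : ℕ, ∀ U, χ U * ((Real.rpow (r U) t * Real.rpow (r' U) (1 - t)) * (Real.log (r U) - Real.log (r' U)) ^ k) ≠ 0 → U ∈ MW :=
    fun k U hU => hχsupp U (left_ne_zero_of_mul hU)
  have hg0' : ∀ k : ℕ, ∀ U, U ∉ MW → χ U * ((Real.rpow (r U) t * Real.rpow (r' U) (1 - t)) * (Real.log (r U) - Real.log (r' U)) ^ k) = 0 :=
    fun k U hU => by rw [hχ0' U hU, zero_mul]
  -- the key pointwise identity: `e^{t h}·(χ·r′) = χ·r^t·r′^{1−t}`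
  have hkey : ∀ U, Real.exp (t * (Real.log (r U) - Real.log (r' U))) * (χ U * r' U)
      = χ U * (Real.rpow (r U) t * Real.rpow (r' U) (1 - t)) := by
    intro U
    by_cases hU : χ U = 0
    · rw [hU, zero_mul, mul_zero, zero_mul]
    · obtain ⟨hr0, hr0'⟩ := hpos U (hχOK U hU)
      have e1 : Real.exp (t * (Real.log (r U) - Real.log (r' U))) * r' U = Real.rpow (r U) t * Real.rpow (r' U) (1 - t) := by
        rw [Real.rpow_eq_pow, Real.rpow_eq_pow, Real.rpow_def_of_pos hr0, Real.rpow_def_of_pos hr0', ← Real.exp_add]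
        conv_lhs => rw [← Real.exp_log hr0']
        rw [Real.log_exp, ← Real.exp_add]
        congr 1; ring
      calc Real.exp (t * (Real.log (r U) - Real.log (r' U))) * (χ U * r' U)
          = χ U * (Real.exp (t * (Real.log (r U) - Real.log (r' U))) * r' U) := by ring
        _ = χ U * (Real.rpow (r U) t * Real.rpow (r' U) (1 - t)) := by rw [e1]
  have hχr'nn : ∀ U, 0 ≤ χ U * r' U := by
    intro U
    by_cases hU : χ U = 0
    · rw [hU, zero_mul]
    · exact mul_nonneg (hχ0 U) (hpos U (hχOK U hU)).2.le
  -- §1 explicit (A1′)∕(A3′) and the (A)-package's (A3)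
  obtain ⟨hA1', c', hA3'⟩ := chartIntegrals_descendTo_of_fibredChart F γ b₀ p₀ j K (Nat.le_of_succ_le hjK) σ₀ hσ₀M hbind₀ hfib₀
    τ Φ hΦ J hJ S hS havgΦ hmap hint B hB hJB
  obtain ⟨c, hA3c⟩ := hA3
  -- moments: lam side `I k V'` and chart side `C k V'`
  set I : ℕ → GaugeField (F.P j) 0 ↥(Matrix.specialUnitaryGroup (Fin 2) ℂ) → ℝ := fun k V' =>
    ∫ U, χ U * ((Real.rpow (r U) t * Real.rpow (r' U) (1 - t)) * (Real.log (r U) - Real.log (r' U)) ^ k) ∂(lam V') with hI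
  set C : ℕ → GaugeField (F.P j) 0 ↥(Matrix.specialUnitaryGroup (Fin 2) ℂ) → ℝ := fun k V' =>
    ∫ z, (J (V', z) : ℝ) * (χ (Φ (V', z)) * ((Real.rpow (r (Φ (V', z))) t * Real.rpow (r' (Φ (V', z))) (1 - t))
      * (Real.log (r (Φ (V', z))) - Real.log (r' (Φ (V', z)))) ^ k)) ∂τ with hC
  -- proportionality a.e. on the window, and positivity of the zeroth moments
  have hprop : ∀ k : ℕ, ∀ᵐ V' ∂(Hf.map (descendTo F ℰp j K (Nat.le_of_succ_le hjK))), V' ∈ W →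
      0 < c V' ∧ 0 < c' V' ∧ I k V' = (c' V' / c V') * C k V' := by
    intro k
    filter_upwards [hA3c _ (hgc k) (hg0' k), hA3' _ (hgc k) (hg0' k)] with V' h1 h2 hV'
    obtain ⟨hc1, e1⟩ := h1 hV'
    obtain ⟨hc2, e2⟩ := h2 hV'
    refine ⟨hc1, hc2, ?_⟩
    have : c V' * I k V' = c' V' * C k V' := by rw [hI, hC]; simp only; rw [← e1, ← e2]
    field_simp
    linarith [this]
  have hI0pos : ∀ V', V' ∈ W → 0 < I 0 V' := by
    intro V' hV'
    haveI := hlam V'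
    have hgnn : ∀ U, 0 ≤ χ U * ((Real.rpow (r U) t * Real.rpow (r' U) (1 - t)) * (Real.log (r U) - Real.log (r' U)) ^ 0) := by
      intro U
      by_cases hU : χ U = 0
      · rw [hU, zero_mul]
      · obtain ⟨hr0, hr0'⟩ := hpos U (hχOK U hU)
        exact mul_nonneg (hχ0 U) (mul_nonneg (mul_nonneg (Real.rpow_nonneg hr0.le _) (Real.rpow_nonneg hr0'.le _)) (by simp))
    have hgi : Integrable (fun U => χ U * ((Real.rpow (r U) t * Real.rpow (r' U) (1 - t)) * (Real.log (r U) - Real.log (r' U)) ^ 0)) (lam V') :=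
      integrable_of_continuous_compact (hgc 0) _
    have hnn : 0 ≤ I 0 V' := integral_nonneg hgnn
    rcases hnn.lt_or_eq with hlt | heq
    · exact hlt
    · exfalso
      have h0 := (integral_eq_zero_iff_of_nonneg hgnn hgi).mp heq.symm
      have hMWm : MeasurableSet MW := measurableSet_multiWindow F γ b₀ p₀ j K
      have : (lam V') MW = 0 := by
        have hsub : ∀ᵐ U ∂(lam V'), U ∈ MW → False := by
          filter_upwards [h0] with U hU hUM
          obtain ⟨hr0, hr0'⟩ := hpos U (hMWOK U hUM)
          have hp : 0 < χ U * ((Real.rpow (r U) t * Real.rpow (r' U) (1 - t)) * (Real.log (r U) - Real.log (r' U)) ^ 0) := by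
            simp only [pow_zero, mul_one]
            exact mul_pos (hχpos U hUM) (mul_pos (Real.rpow_pos_of_pos hr0 _) (Real.rpow_pos_of_pos hr0' _))
          exact hp.ne' hU
        exact measure_eq_zero_iff_ae_notMem.mpr (by filter_upwards [hsub] with U hU hUM; exact hU hUM)
      exact (hA2 V' hV').ne' this
  have hC0pos : ∀ V', V' ∈ W → 0 < C 0 V' := by
    intro V' hV'
    obtain ⟨Cb, hCb⟩ := isCompact_univ.exists_bound_of_continuousOn (hgc 0).continuousOn
    have hgi : Integrable (fun z => (J (V', z) : ℝ) * (χ (Φ (V', z)) * ((Real.rpow (r (Φ (V', z))) t * Real.rpow (r' (Φ (V', z))) (1 - t))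
        * (Real.log (r (Φ (V', z))) - Real.log (r' (Φ (V', z)))) ^ 0))) τ := by
      refine (hB.mul_const ‖Cb‖).mono' (((hJV V').coe_nnreal_real).mul ((hgm 0).comp (hΦV V'))).aestronglyMeasurable ?_
      filter_upwards [hJB V' hV'] with z hz
      rw [norm_mul, Real.norm_eq_abs, abs_of_nonneg (J (V', z)).coe_nonneg]
      exact mul_le_mul hz ((hCb _ (mem_univ _)).trans (Real.norm_eq_abs _ ▸ le_abs_self _)) (norm_nonneg _)
        ((J (V', z)).coe_nonneg.trans hz)
    have hgnn : ∀ z, 0 ≤ (J (V', z) : ℝ) * (χ (Φ (V', z)) * ((Real.rpow (r (Φ (V', z))) t * Real.rpow (r' (Φ (V', z))) (1 - t))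
        * (Real.log (r (Φ (V', z))) - Real.log (r' (Φ (V', z)))) ^ 0)) := by
      intro z
      refine mul_nonneg (J (V', z)).coe_nonneg ?_
      by_cases hU : χ (Φ (V', z)) = 0
      · rw [hU, zero_mul]
      · obtain ⟨hr0, hr0'⟩ := hpos _ (hχOK _ hU)
        exact mul_nonneg (hχ0 _) (mul_nonneg (mul_nonneg (Real.rpow_nonneg hr0.le _) (Real.rpow_nonneg hr0'.le _)) (by simp))
    have hnn : 0 ≤ C 0 V' := integral_nonneg hgnn
    rcases hnn.lt_or_eq with hlt | heq
    · exact hlt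
    · exfalso
      have h0 := (integral_eq_zero_iff_of_nonneg hgnn hgi).mp heq.symm
      have hJ0 : ∀ᵐ z ∂τ, z ∈ {z | Φ (V', z) ∈ MW} → (J (V', z) : ℝ≥0∞) = 0 := by
        filter_upwards [h0] with z hz hzM
        obtain ⟨hr0, hr0'⟩ := hpos _ (hMWOK _ hzM)
        have hp : 0 < χ (Φ (V', z)) * ((Real.rpow (r (Φ (V', z))) t * Real.rpow (r' (Φ (V', z))) (1 - t))
            * (Real.log (r (Φ (V', z))) - Real.log (r' (Φ (V', z)))) ^ 0) := by
          simp only [pow_zero, mul_one]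
          exact mul_pos (hχpos _ hzM) (mul_pos (Real.rpow_pos_of_pos hr0 _) (Real.rpow_pos_of_pos hr0' _))
        have hprod : (J (V', z) : ℝ) * _ = 0 := hz
        rcases mul_eq_zero.mp hprod with hJz | hgz
        · rw [ENNReal.coe_eq_zero]; exact_mod_cast hJz
        · exact absurd hgz hp.ne'
      have hM : MeasurableSet {z | Φ (V', z) ∈ MW} := (hΦV V') (measurableSet_multiWindow F γ b₀ p₀ j K)
      have hz : ∫⁻ z in {z | Φ (V', z) ∈ MW}, (J (V', z) : ℝ≥0∞) ∂τ = 0 := by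
        rw [← lintegral_zero (μ := τ.restrict _)]
        exact lintegral_congr_ae ((ae_restrict_iff' hM).mpr hJ0)
      exact (hmass V' hV').ne' hz
  -- the two ratio functions, window-continuous
  set Rl : GaugeField (F.P j) 0 ↥(Matrix.specialUnitaryGroup (Fin 2) ℂ) → ℝ := fun V' =>
    (I 2 V' - 2 * (I 1 V' / I 0 V') * I 1 V' + (I 1 V' / I 0 V') ^ 2 * I 0 V') / I 0 V' with hRl
  set Rc : GaugeField (F.P j) 0 ↥(Matrix.specialUnitaryGroup (Fin 2) ℂ) → ℝ := fun V' =>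
    (C 2 V' - 2 * (C 1 V' / C 0 V') * C 1 V' + (C 1 V' / C 0 V') ^ 2 * C 0 V') / C 0 V' with hRc
  have hIc : ∀ k, ContinuousOn (I k) W := fun k => hA1 _ (hgc k) (hgsupp k)
  have hCc : ∀ k, ContinuousOn (C k) W := fun k => hA1' _ (hgc k) (hgsupp k)
  have hRlc : ContinuousOn Rl W := by
    have h0 : ∀ V' ∈ W, I 0 V' ≠ 0 := fun V' hV' => (hI0pos V' hV').ne'
    have hq : ContinuousOn (fun V' => I 1 V' / I 0 V') W := (hIc 1).div (hIc 0) h0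
    exact ((((hIc 2).sub ((continuousOn_const.mul hq).mul (hIc 1))).add ((hq.pow 2).mul (hIc 0))).div (hIc 0) h0)
  have hRcc : ContinuousOn Rc W := by
    have h0 : ∀ V' ∈ W, C 0 V' ≠ 0 := fun V' hV' => (hC0pos V' hV').ne'
    have hq : ContinuousOn (fun V' => C 1 V' / C 0 V') W := (hCc 1).div (hCc 0) h0
    exact ((((hCc 2).sub ((continuousOn_const.mul hq).mul (hCc 1))).add ((hq.pow 2).mul (hCc 0))).div (hCc 0) h0)
  -- a.e. on the window the two ratios agree (proportional moments), hence everywhere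
  have hae0 : ∀ᵐ V' ∂(Hf.map (descendTo F ℰp j K (Nat.le_of_succ_le hjK))), V' ∈ W → Rl V' = Rc V' := by
    filter_upwards [hprop 0, hprop 1, hprop 2] with V' h0 h1 h2 hV'
    obtain ⟨hc0, hc0', e0⟩ := h0 hV'
    obtain ⟨-, -, e1⟩ := h1 hV'
    obtain ⟨-, -, e2⟩ := h2 hV'
    exact ratio_eq_of_proportional (div_pos hc0' hc0).ne' (hC0pos V' hV').ne' e0 e1 e2
  have hρX : AEMeasurable (fun V => ENNReal.ofReal (rj V)) Hc := hrj.ennreal_ofReal.aemeasurable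
  have hWne : ∀ V' ∈ W, ENNReal.ofReal (rj V') ≠ 0 := fun V' hV' => (ENNReal.ofReal_pos.mpr (hrjpos V' hV')).ne'
  have hae1 := OrganTangentFibreMeanVersionKnit.ae_on_of_ae_map_of_ac_of_map_eq _ hd _ Hf Measure.AbsolutelyContinuous.rfl hρX hcons hWne hae0
  have hae : ∀ᵐ V' ∂Hc, PlaqSmall θj V' → Rl V' = Rc V' := by
    filter_upwards [hae1] with V' h hV'
    exact h hV' hV'
  have hall := OrganTangentFibreMeanTransport.eq_on_window_of_ae (F.P j) 0 θj hRlc hRcc hae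
  -- at the given window point: variance = lam ratio = chart ratio = centred chart form
  haveI := hlam V
  have hflt : ∀ᵐ U ∂(lam V), ENNReal.ofReal (χ U * r' U) < ⊤ := Eventually.of_forall fun _ => ENNReal.ofReal_lt_top
  have hdm : Measurable fun U => ENNReal.ofReal (χ U * r' U) := (hχc.measurable.mul hrm').ennreal_ofReal
  -- integrals against the reweighted fibre law are `lam`-integrals of `g₀·h^k`
  have hwd : ∀ k : ℕ, ∫ U, Real.exp (t * (Real.log (r U) - Real.log (r' U))) * (Real.log (r U) - Real.log (r' U)) ^ k
        ∂((lam V).withDensity fun U => ENNReal.ofReal (χ U * r' U)) = I k V := by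
    intro k
    rw [integral_withDensity_eq_integral_toReal_smul hdm hflt]
    refine integral_congr_ae (Eventually.of_forall fun U => ?_)
    simp only [smul_eq_mul, ENNReal.toReal_ofReal (hχr'nn U)]
    linear_combination ((Real.log (r U) - Real.log (r' U)) ^ k) * hkey U
  have hwi : ∀ k : ℕ, Integrable (fun U => Real.exp (t * (Real.log (r U) - Real.log (r' U))) * (Real.log (r U) - Real.log (r' U)) ^ k)
        ((lam V).withDensity fun U => ENNReal.ofReal (χ U * r' U)) := by
    intro k
    rw [integrable_withDensity_iff_integrable_smul' hdm hflt]
    have heq : (fun U => (ENNReal.ofReal (χ U * r' U)).toReal • (Real.exp (t * (Real.log (r U) - Real.log (r' U))) * (Real.log (r U) - Real.log (r' U)) ^ k))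
        = fun U => χ U * ((Real.rpow (r U) t * Real.rpow (r' U) (1 - t)) * (Real.log (r U) - Real.log (r' U)) ^ k) := by
      funext U
      simp only [smul_eq_mul, ENNReal.toReal_ofReal (hχr'nn U)]
      linear_combination ((Real.log (r U) - Real.log (r' U)) ^ k) * hkey U
    rw [heq]
    exact integrable_of_continuous_compact (hgc k) _
  have hhm : Measurable (fun U => Real.log (r U) - Real.log (r' U)) := hrm.log.sub hrm'.log
  have hwi0 : Integrable (fun U => Real.exp (t * (Real.log (r U) - Real.log (r' U))))
      ((lam V).withDensity fun U => ENNReal.ofReal (χ U * r' U)) := by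
    refine (hwi 0).congr (Eventually.of_forall fun U => ?_); simp only [pow_zero, mul_one]
  have hwi1 : Integrable (fun U => Real.exp (t * (Real.log (r U) - Real.log (r' U))) * (Real.log (r U) - Real.log (r' U)))
      ((lam V).withDensity fun U => ENNReal.ofReal (χ U * r' U)) := by
    refine (hwi 1).congr (Eventually.of_forall fun U => ?_); simp only [pow_one]
  have hwd0 : ∫ U, Real.exp (t * (Real.log (r U) - Real.log (r' U))) ∂((lam V).withDensity fun U => ENNReal.ofReal (χ U * r' U)) = I 0 V := by
    rw [← hwd 0]; exact integral_congr_ae (Eventually.of_forall fun U => by simp only [pow_zero, mul_one])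
  have hwd1 : ∫ U, Real.exp (t * (Real.log (r U) - Real.log (r' U))) * (Real.log (r U) - Real.log (r' U))
      ∂((lam V).withDensity fun U => ENNReal.ofReal (χ U * r' U)) = I 1 V := by
    rw [← hwd 1]; exact integral_congr_ae (Eventually.of_forall fun U => by simp only [pow_one])
  have hvar : variance (fun U => Real.log (r U) - Real.log (r' U))
      (((lam V).withDensity (fun U => ENNReal.ofReal (χ U * r' U))).tilted (fun U => t * (Real.log (r U) - Real.log (r' U)))) = Rl V := by
    rw [variance_tilted_eq_ratio ((lam V).withDensity fun U => ENNReal.ofReal (χ U * r' U)) hhm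
      (f := fun U => t * (Real.log (r U) - Real.log (r' U))) hwi0 hwi1 (hwi 2), hwd0, hwd1, hwd 2]
  rw [hvar, hall V hV, hRc]
  simp only
  -- the chart ratio in centred form
  have hCi : ∀ k : ℕ, Integrable (fun z => (J (V, z) : ℝ) * (χ (Φ (V, z)) * ((Real.rpow (r (Φ (V, z))) t * Real.rpow (r' (Φ (V, z))) (1 - t))
      * (Real.log (r (Φ (V, z))) - Real.log (r' (Φ (V, z)))) ^ k))) τ := by
    intro k
    obtain ⟨Cb, hCb⟩ := isCompact_univ.exists_bound_of_continuousOn (hgc k).continuousOn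
    refine (hB.mul_const ‖Cb‖).mono' (((hJV V).coe_nnreal_real).mul ((hgm k).comp (hΦV V))).aestronglyMeasurable ?_
    filter_upwards [hJB V hV] with z hz
    rw [norm_mul, Real.norm_eq_abs, abs_of_nonneg (J (V, z)).coe_nonneg]
    exact mul_le_mul hz ((hCb _ (mem_univ _)).trans (Real.norm_eq_abs _ ▸ le_abs_self _)) (norm_nonneg _)
      ((J (V, z)).coe_nonneg.trans hz)
  have hw0 : Integrable (fun z => χ (Φ (V, z)) * (Real.rpow (r (Φ (V, z))) t * Real.rpow (r' (Φ (V, z))) (1 - t)) * (J (V, z) : ℝ)) τ := by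
    refine (hCi 0).congr (Eventually.of_forall fun z => ?_); simp only [pow_zero, mul_one]; ring
  have hw1 : Integrable (fun z => (Real.log (r (Φ (V, z))) - Real.log (r' (Φ (V, z))))
      * (χ (Φ (V, z)) * (Real.rpow (r (Φ (V, z))) t * Real.rpow (r' (Φ (V, z))) (1 - t)) * (J (V, z) : ℝ))) τ := by
    refine (hCi 1).congr (Eventually.of_forall fun z => ?_); simp only [pow_one]; ring
  have hw2 : Integrable (fun z => (Real.log (r (Φ (V, z))) - Real.log (r' (Φ (V, z)))) ^ 2
      * (χ (Φ (V, z)) * (Real.rpow (r (Φ (V, z))) t * Real.rpow (r' (Φ (V, z))) (1 - t)) * (J (V, z) : ℝ))) τ := by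
    refine (hCi 2).congr (Eventually.of_forall fun z => ?_); simp only; ring
  have hc0 : C 0 V = ∫ z, χ (Φ (V, z)) * (Real.rpow (r (Φ (V, z))) t * Real.rpow (r' (Φ (V, z))) (1 - t)) * (J (V, z) : ℝ) ∂τ := by
    rw [hC]; exact integral_congr_ae (Eventually.of_forall fun z => by simp only [pow_zero, mul_one]; ring)
  have hc1 : C 1 V = ∫ z, (Real.log (r (Φ (V, z))) - Real.log (r' (Φ (V, z))))
      * (χ (Φ (V, z)) * (Real.rpow (r (Φ (V, z))) t * Real.rpow (r' (Φ (V, z))) (1 - t)) * (J (V, z) : ℝ)) ∂τ := by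
    rw [hC]; exact integral_congr_ae (Eventually.of_forall fun z => by simp only [pow_one]; ring)
  have hc2 : C 2 V = ∫ z, (Real.log (r (Φ (V, z))) - Real.log (r' (Φ (V, z)))) ^ 2
      * (χ (Φ (V, z)) * (Real.rpow (r (Φ (V, z))) t * Real.rpow (r' (Φ (V, z))) (1 - t)) * (J (V, z) : ℝ)) ∂τ := by
    rw [hC]; exact integral_congr_ae (Eventually.of_forall fun z => by simp only; ring)
  rw [hc0, hc1, hc2]
  exact ratio_eq_integral_centred_sq τ hw0 hw1 hw2

end Summit.QuantumFields.YangMills.Theorems.OrganTangentChartVarianceRepresentation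

end
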